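import Summits.RiemannHypothesis.RiemannHypothesis.Theorems.PfPersistenceInWindowMirror
import HarnessLib

/-!
# PF persistence — the GENERIC TOP-TWIN LEMMA (pub-rhpf, barrier-typer gen 4; carver R12 (c), ACK A53(1)-C2)

**HONEST FRAMING. This is a long-odds MECHANISM SEARCH; no RH claims.** RH-free linear algebra about the cell's
records; nothing here bears on the truth of RH.

cand-2's TOP TWIN `T₂* = λ-pert(2, 1 + 3.8·10⁻²⁵⁹)` is sign-identical to `ζ` at all 650 served windows and negative
only at `(1.96, N ≥ 400)` (DATA). The GENERIC LEMMA behind it (DERIVED until now, typed and PROVED here):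

* `exists_topTwin` (PROVED): let `G` be a finite set of windows on which `ζ`'s bottoms are at least `m > 0`
  (sign margin of the grid), `wtop` any window holding the prime `p` (`log p ≤ 2a`), and `u` a direction at `wtop`
  with nonzero pattern leverage `s = uᵀP_p u` satisfying the LEVERAGE CONDITION `uᵀQ_ζ(wtop)u < m·|s|`. Then ONE
  in-window dial `(p, K)`, `K ≠ 1`, with `2 w(p)|K − 1| < m`, gives an arithmetic record whose bottoms are STILL
  POSITIVE at every window of `G` (sign-identical to `ζ` on the grid, by the `τ_unif`-Lipschitz law of `ε₁` along the
  dial path) and which is FORM-NEGATIVE at `wtop`. (With `u = u₁(ζ; wtop)` the condition reads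
  `ε₁(ζ; wtop) < m · |u₁ᵀP_p u₁|/|u₁|²`: the top margin is below the grid margin times the leverage — cand-2's regime.)
* `not_separates_of_factorsThrough_gridSigns` (PROVED): consequently no class factoring through the SIGN VECTOR
  `(ε₁(·; w) > 0)_{w ∈ G}` of a finite grid separates `ζ` from the detectably negative arithmetic records, as soon as
  ONE window `wtop` (outside `G` necessarily — e.g. a finer truncation at the top height) satisfies the leverage
  condition: the closing twin is IN-WINDOW (`p` inside every window of height `≥ (log p)/2`), not a far dial —
  the same-window / served-menu word of A41-DOM for grid sign readers ("closed at top", A53 R-TOP).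
-/

set_option linter.dupNamespace false  -- the mandated namespace repeats `RiemannHypothesis`

noncomputable section

open Real Finset Matrix Set

namespace Summit.RiemannHypothesis.RiemannHypothesis.Theorems.PfPersistence

/-- PROVED: a dial `K` with `2 w(p) |K − 1| < m` keeps the bottom POSITIVE at every window where `ζ`'s bottom is at
least `m` (whether or not the window holds `p`). [folklore] -/
theorem dialBottom_pos_of_margin {p : ℕ} {K m : ℝ} (hK : 2 * |zetaWeights p| * |K - 1| < m) {win : Window}
    (hwin : m ≤ bottomRayleigh (zetaDatum win)) : 0 < dialBottom p win K := by
  have h := abs_dialBottom_sub_le p win K 1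
  rw [dialBottom_one] at h
  have h' := (abs_le.1 h).1
  linarith

/-- **PROVED — THE GENERIC TOP-TWIN LEMMA.** See the module docstring. [folklore] -/
theorem exists_topTwin (G : Finset Window) {m : ℝ} (hm : 0 < m) (hG : ∀ win ∈ G, m ≤ bottomRayleigh (zetaDatum win))
    {wtop : Window} {p : ℕ} (hp : p.Prime) (hpw : p ∈ primeRange (2 * wtop.a)) {u : Fin (wtop.N + 1) → ℝ}
    (hs : u ⬝ᵥ (primePattern p wtop *ᵥ u) ≠ 0)
    (hlev : u ⬝ᵥ (zetaDatum wtop *ᵥ u) < m * |u ⬝ᵥ (primePattern p wtop *ᵥ u)|) :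
    ∃ K : ℝ, K ≠ 1 ∧ 2 * |zetaWeights p| * |K - 1| < m ∧
      (∀ win ∈ G, 0 < bottomRayleigh (datumOf (dial p K zetaWeights) win)) ∧
      u ⬝ᵥ (datumOf (dial p K zetaWeights) wtop *ᵥ u) < 0 := by
  set q := u ⬝ᵥ (zetaDatum wtop *ᵥ u) with hq
  set s := u ⬝ᵥ (primePattern p wtop *ᵥ u) with hsdef
  have hw : 0 < zetaWeights p := zetaWeights_pos_of_prime hp
  have hsabs : 0 < |s| := abs_pos.2 hs
  -- the target displacement `r ∈ (max(q/|s|, 0), m)`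
  set M := max (q / |s|) 0 with hM
  have hMm : M < m := max_lt ((div_lt_iff₀ hsabs).2 hlev) hm
  set r := (M + m) / 2 with hr
  have hrM : M < r := by rw [hr]; linarith
  have hrm : r < m := by rw [hr]; linarith
  have hr0 : 0 < r := lt_of_le_of_lt (le_max_right _ _) hrM
  have hrq : q < r * |s| := by
    have : q / |s| < r := lt_of_le_of_lt (le_max_left _ _) hrM
    exact (div_lt_iff₀ hsabs).1 this
  -- the dial: `2 (K − 1) w(p) s = r |s|`, `2 w(p) |K − 1| = r`
  set K : ℝ := 1 + r * s / (2 * zetaWeights p * |s|) with hKdef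
  have hden : 2 * zetaWeights p * |s| ≠ 0 := by positivity
  have hK1 : K - 1 = r * s / (2 * zetaWeights p * |s|) := by rw [hKdef]; ring
  have habsK : 2 * |zetaWeights p| * |K - 1| = r := by
    rw [hK1, abs_div, abs_mul, abs_mul, abs_mul, abs_abs, abs_of_pos hr0, abs_of_pos hw, abs_two]
    field_simp
  have hKne : K ≠ 1 := by
    intro h
    have : 2 * |zetaWeights p| * |K - 1| = 0 := by rw [h, sub_self, abs_zero, mul_zero]
    linarith
  refine ⟨K, hKne, by rw [habsK]; exact hrm, fun win hwin => ?_, ?_⟩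
  · exact dialBottom_pos_of_margin (by rw [habsK]; exact hrm) (hG win hwin)
  · show u ⬝ᵥ (evenBlock (dial p K zetaWeights) wtop *ᵥ u) < 0
    rw [form_evenBlock_dial hpw]
    change q - 2 * (K - 1) * zetaWeights p * s < 0
    have hprod : 2 * (K - 1) * zetaWeights p * s = r * |s| := by
      rw [hK1]
      field_simp
      exact (sq_abs s).symm
    rw [hprod]
    linarith

/-- **PROVED — THE TOP TWIN AS AN ARITHMETIC RECORD:** under the hypotheses of `exists_topTwin` there is
`d ∈ arithDialSpace`, `d ≠ ζ`, with positive bottoms on all of `G` and form-negative (detectably negative) at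
`wtop`. [folklore] -/
theorem exists_topTwin_mem_arithDialSpace (G : Finset Window) {m : ℝ} (hm : 0 < m)
    (hG : ∀ win ∈ G, m ≤ bottomRayleigh (zetaDatum win)) {wtop : Window} {p : ℕ} (hp : p.Prime)
    (hpw : p ∈ primeRange (2 * wtop.a)) {u : Fin (wtop.N + 1) → ℝ} (hs : u ⬝ᵥ (primePattern p wtop *ᵥ u) ≠ 0)
    (hlev : u ⬝ᵥ (zetaDatum wtop *ᵥ u) < m * |u ⬝ᵥ (primePattern p wtop *ᵥ u)|) :
    ∃ d ∈ arithDialSpace, d ≠ zetaDatum ∧ (∀ win ∈ G, 0 < bottomRayleigh (d win)) ∧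
      (∃ v : Fin (wtop.N + 1) → ℝ, v ⬝ᵥ (d wtop *ᵥ v) < 0) ∧ DetectablyNegative d := by
  obtain ⟨K, hK1, -, hGpos, hneg⟩ := exists_topTwin G hm hG hp hpw hs hlev
  exact ⟨_, datumOf_dial_zeta_mem_arithDialSpace p K, datumOf_dial_ne_zetaDatum (zetaWeights_pos_of_prime hp) hK1,
    hGpos, ⟨u, hneg⟩, wtop, u, hneg⟩

/-- the SIGN VECTOR of the bottoms on a finite grid `G`, as the set of grid windows with positive bottom (the
reading of every grid sign reader). [folklore] -/
def gridSigns (G : Finset Window) (d : Datum) : Set Window := {w | w ∈ G ∧ 0 < bottomRayleigh (d w)}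

/-- PROVED: the top twin has `ζ`'s sign vector on the grid. [folklore] -/
theorem gridSigns_eq_of_pos (G : Finset Window) {d : Datum} (hd : ∀ win ∈ G, 0 < bottomRayleigh (d win))
    (hζ : ∀ win ∈ G, 0 < bottomRayleigh (zetaDatum win)) : gridSigns G d = gridSigns G zetaDatum :=
  Set.ext fun w => ⟨fun h => ⟨h.1, hζ w h.1⟩, fun h => ⟨h.1, hd w h.1⟩⟩

/-- **PROVED — GRID SIGN READERS ARE CLOSED AT THE TOP (A53 R-TOP, generic form):** if some window `wtop` satisfies
the leverage condition against the grid margin `m`, no class factoring through the sign vector of the bottoms on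
the finite grid `G` separates `ζ` from the detectably negative data of any domain `⊇ arithDialSpace`; the witness
is ONE in-window dial. [folklore] -/
theorem not_separates_of_factorsThrough_gridSigns (G : Finset Window) {m : ℝ} (hm : 0 < m)
    (hG : ∀ win ∈ G, m ≤ bottomRayleigh (zetaDatum win)) {wtop : Window} {p : ℕ} (hp : p.Prime)
    (hpw : p ∈ primeRange (2 * wtop.a)) {u : Fin (wtop.N + 1) → ℝ} (hs : u ⬝ᵥ (primePattern p wtop *ᵥ u) ≠ 0)
    (hlev : u ⬝ᵥ (zetaDatum wtop *ᵥ u) < m * |u ⬝ᵥ (primePattern p wtop *ᵥ u)|)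
    {S Dm : Set Datum} (hS : FactorsThrough S (gridSigns G)) (hD : arithDialSpace ⊆ Dm) :
    ¬ Separates S Dm zetaDatum := by
  rintro ⟨hζS, hsep⟩
  obtain ⟨d, hd, -, hGpos, -, hneg⟩ := exists_topTwin_mem_arithDialSpace G hm hG hp hpw hs hlev
  have hsig := gridSigns_eq_of_pos G hGpos fun win hwin => lt_of_lt_of_le hm (hG win hwin)
  exact hsep d (hD hd) hneg ((hS d zetaDatum hsig).2 hζS)

end Summit.RiemannHypothesis.RiemannHypothesis.Theorems.PfPersistence

end
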